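import Summits.ResolutionOfSingularities.ResolutionOfSingularities.Theorems.TameAbelianQuotientLU3
import HarnessLib

/-!
# TameAbelianQuotientLU (4/5) — the abelian quotient cut of the located residual; ROOT BY NAME

Part 4 of the g26 node `TameAbelianQuotientLU` of the ROOT/RESIDUAL decomposition cell
`decomp-res` (lens 1, window (W-ab) of critic row 193); see the module docstring of
`Summits.ResolutionOfSingularities.ResolutionOfSingularities.Theorems.TameAbelianQuotientLU` (part 1/5) for the thesis, the law,
the residual R26, the cuts and the sources.  Problem side, sorry-free, hypothesis-free.

This part: R26 `NonKHToricArchLUKeyHenselDescentAbel`, the decided cell piece, the exact cuts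
`nonKHToricArchLUKeyHenselDescentQuot_iff_abel : R25 ↔ R26` and
`nonKHToricArchLUKeyHenselDescent_iff_abel : R23 ↔ R26` (hypothesis-free), `closes_abel` (the summit
`_root_.ResolutionOfSingularities` by name) and `root_iff_abel_sigma`.
-/

noncomputable section

open IntermediateField Polynomial Literature.AlgebraicGeometry.Resolution IsLocalRing

namespace Summit.ResolutionOfSingularities.ResolutionOfSingularities.Theorems.TameAbelianQuotientLU

/-! ## Part C — the ABELIAN QUOTIENT CUT of the located residual; ROOT BY NAME -/

section Cut

open Summit.ResolutionOfSingularities.ResolutionOfSingularities.Theses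
open Summit.ResolutionOfSingularities.ResolutionOfSingularities.Theorems
open Summit.ResolutionOfSingularities.ResolutionOfSingularities.Theorems.KeyChainLU
open Summit.ResolutionOfSingularities.ResolutionOfSingularities.Theorems.HenselKeyChainLU
open Summit.ResolutionOfSingularities.ResolutionOfSingularities.Theorems.GaloisDescentLU
open Summit.ResolutionOfSingularities.ResolutionOfSingularities.Theorems.PfaffLine
open Summit.ResolutionOfSingularities.ResolutionOfSingularities.Theorems.ToricLadder
open Summit.ResolutionOfSingularities.ResolutionOfSingularities.Theorems.KaplanskyLadder
open Summit.ResolutionOfSingularities.ResolutionOfSingularities.Theorems.PerronLadder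
open Summit.ResolutionOfSingularities.ResolutionOfSingularities.Theorems.DefectlessLadder
open Summit.ResolutionOfSingularities.ResolutionOfSingularities.Theorems.WCut
open Summit.ResolutionOfSingularities.ResolutionOfSingularities.Theorems.TameQuotientLU

/-- **DECIDED PIECE** (tag DECIDED — a kernel THEOREM,
`nonKHToricArchLUKeyHenselDescentAbelCell_holds`; WEAKER than the root; located at
`(e, c, n) = (3, 3, 4)`): the located residual of g23 (off the key-chain, Hensel and descent
cells) restricted to the TAME ABELIAN QUOTIENT CELL. -/
def NonKHToricArchLUKeyHenselDescentAbelCell (e c n : ℕ) : Prop :=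
  ∀ p : ℕ, p.Prime → ∀ (k K : Type) [Field k] [CharP k p] [Field K] [Algebra k K],
    Algebra.trdeg k K ≤ n → ∀ O : ValuationSubring K, Nonempty O.valuation.RankOne →
    (∀ y ∈ O, ∃ f : Polynomial k, f ≠ 0 ∧ Polynomial.aeval y f ∈ O.nonunits) →
    ¬ IsAbhyankarPlace O (algebraMap k K).fieldRange ⊤ →
    ¬ (∃ d : ℕ, d < n ∧ SepDenseBelow k O d) → ¬ ToricDenseBelow k O e → ¬ KHTopBelow k O c →
    ¬ KeyChainTopBelow k O → ¬ HenselKeyChainTopBelow k O → ¬ GaloisHenselDescentDatum k O →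
    TameAbelianEquivariantLUAbove k O → RelLocalUniformization k K O

/-- THE LAW DECIDES THE CELL PIECE outright, for all parameters (no port, no hypothesis, no
`TheoremD`). [folklore] -/
theorem nonKHToricArchLUKeyHenselDescentAbelCell_holds (e c n : ℕ) :
    NonKHToricArchLUKeyHenselDescentAbelCell e c n :=
  fun _ _ _ _ _ _ _ _ _ _ _ _ _ _ _ _ _ _ _ hT => relLU_of_tameAbelianEquivariantLUAbove hT

/-- **NEW LOCATED RESIDUAL R26** (tag UNDECIDED · WEAKER than the root · located at
`(e, c, n) = (3, 3, 4)`): the located residual OFF the key-chain cell, OFF the Hensel cell, OFF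
the descent cell AND OFF the tame ABELIAN quotient cell (hence off the cyclic tame-quotient cell
of R25) — no tame abelian top with `G = G_Z` and residues in `k` carries `G`-equivariant
uniformization of the models of `K`.  R25 with its last binder replaced. -/
def NonKHToricArchLUKeyHenselDescentAbel (e c n : ℕ) : Prop :=
  ∀ p : ℕ, p.Prime → ∀ (k K : Type) [Field k] [CharP k p] [Field K] [Algebra k K],
    Algebra.trdeg k K ≤ n → ∀ O : ValuationSubring K, Nonempty O.valuation.RankOne →
    (∀ y ∈ O, ∃ f : Polynomial k, f ≠ 0 ∧ Polynomial.aeval y f ∈ O.nonunits) →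
    ¬ IsAbhyankarPlace O (algebraMap k K).fieldRange ⊤ →
    ¬ (∃ d : ℕ, d < n ∧ SepDenseBelow k O d) → ¬ ToricDenseBelow k O e → ¬ KHTopBelow k O c →
    ¬ KeyChainTopBelow k O → ¬ HenselKeyChainTopBelow k O → ¬ GaloisHenselDescentDatum k O →
    ¬ TameAbelianEquivariantLUAbove k O → RelLocalUniformization k K O

/-- Dropping the extra negated hypothesis. [folklore] -/
theorem nonKHToricArchLUKeyHenselDescentAbel_of_descent {e c n : ℕ}
    (h : NonKHToricArchLUKeyHenselDescent e c n) : NonKHToricArchLUKeyHenselDescentAbel e c n :=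
  fun p hp k K _ _ _ _ hd O h1 h0 hA hnd hnt hnk hkey hH hG _ =>
    h p hp k K hd O h1 h0 hA hnd hnt hnk hkey hH hG

/-- R25 ⇒ R26 through the ONE BINDER `¬ TameAbelianEquivariantLUAbove ⇒ ¬ TameEquivariantLUAbove`
(cell inclusion, contrapositive). [folklore] -/
theorem nonKHToricArchLUKeyHenselDescentAbel_of_quot {e c n : ℕ}
    (h : NonKHToricArchLUKeyHenselDescentQuot e c n) : NonKHToricArchLUKeyHenselDescentAbel e c n :=
  fun p hp k K _ _ _ _ hd O h1 h0 hA hnd hnt hnk hkey hH hG hT =>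
    h p hp k K hd O h1 h0 hA hnd hnt hnk hkey hH hG (not_tameEquivariantLUAbove_of_not_abelian hT)

/-- **THE TAME ABELIAN QUOTIENT CUT `R25 ↔ R26`** (kernel, exact, hypothesis-free — the cut named in
the window): the g25 located residual off the cyclic tame-quotient cell is EQUIVALENT to its part
off the tame ABELIAN quotient cell — on the difference the abelian law decides. [folklore] -/
theorem nonKHToricArchLUKeyHenselDescentQuot_iff_abel {e c n : ℕ} :
    NonKHToricArchLUKeyHenselDescentQuot e c n ↔ NonKHToricArchLUKeyHenselDescentAbel e c n := by
  refine ⟨nonKHToricArchLUKeyHenselDescentAbel_of_quot,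
    fun h p hp k K _ _ _ _ hd O hr hz hA hnd hnt hnk hkey hH hG _ => ?_⟩
  by_cases hT : TameAbelianEquivariantLUAbove k O
  · exact relLU_of_tameAbelianEquivariantLUAbove hT
  · exact h p hp k K hd O hr hz hA hnd hnt hnk hkey hH hG hT

/-- The cut at the programme's parameters `(3, 3, 4)` (`R25 ↔ R26`, hypothesis-free). [folklore] -/
theorem nonKHToricArchLUKeyHenselDescentQuot334_iff_abel :
    NonKHToricArchLUKeyHenselDescentQuot 3 3 4 ↔ NonKHToricArchLUKeyHenselDescentAbel 3 3 4 :=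
  nonKHToricArchLUKeyHenselDescentQuot_iff_abel

/-- **The composite cut `R23 ↔ R26`** (kernel, exact, hypothesis-free): the g23 located residual
R23 is EQUIVALENT to its part R26 off the tame abelian quotient cell — on the cell the law
decides. [folklore] -/
theorem nonKHToricArchLUKeyHenselDescent_iff_abel {e c n : ℕ} :
    NonKHToricArchLUKeyHenselDescent e c n ↔ NonKHToricArchLUKeyHenselDescentAbel e c n := by
  refine ⟨nonKHToricArchLUKeyHenselDescentAbel_of_descent,
    fun h p hp k K _ _ _ _ hd O hr hz hA hnd hnt hnk hkey hH hG => ?_⟩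
  by_cases hT : TameAbelianEquivariantLUAbove k O
  · exact relLU_of_tameAbelianEquivariantLUAbove hT
  · exact h p hp k K hd O hr hz hA hnd hnt hnk hkey hH hG hT

/-- The EXACT re-location at the programme's parameters `(3, 3, 4)` (`R23 ↔ R26`,
hypothesis-free). [folklore] -/
theorem nonKHToricArchLUKeyHenselDescent334_iff_abel :
    NonKHToricArchLUKeyHenselDescent 3 3 4 ↔ NonKHToricArchLUKeyHenselDescentAbel 3 3 4 :=
  nonKHToricArchLUKeyHenselDescent_iff_abel

/-- The TRUE residual family of g17/g20 (`NonKHToricArchLU`) re-located: off the key-chain,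
Hensel, descent and tame-abelian-quotient cells. [folklore] -/
theorem nonKHToricArchLU_iff_abel {e c n : ℕ} :
    NonKHToricArchLU e c n ↔ NonKHToricArchLUKeyHenselDescentAbel e c n :=
  nonKHToricArchLU_iff_descent.trans nonKHToricArchLUKeyHenselDescent_iff_abel

/-- The new residual follows from the root outright (it is a WEAKER piece). [folklore] -/
theorem nonKHToricArchLUKeyHenselDescentAbel_of_root (hS : _root_.ResolutionOfSingularities)
    (e c n : ℕ) : NonKHToricArchLUKeyHenselDescentAbel e c n :=
  nonKHToricArchLUKeyHenselDescentAbel_of_descent (nonKHToricArchLUKeyHenselDescent_of_root hS e c n)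

/-- **`closes_abel` — ROOT BY NAME (deciding theorem of this node).**  Cossart–Piltant floor
(print) + CJS-2020 (named fact) + the KK05 (NC)+(V) ascent Π₁ (print) + the located residual OFF
THE KEY-CHAIN, HENSEL, DESCENT AND TAME-ABELIAN-QUOTIENT CELLS in transcendence degree `≥ 4` +
the patching crux 0642 ⇒ `ResolutionOfSingularities`; all four cells are discharged INSIDE the
kernel. [folklore] -/
theorem closes_abel (hCP : CossartPiltant2019LU3.{0}) (hCJS : CossartJannsenSaito2020Embedded.{0})
    (hAsc : KK05NCVAscent) (hN : ∀ d, 4 ≤ d → NonKHToricArchLUKeyHenselDescentAbel 3 3 d)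
    (h₃ : Valuative.PatchingRel) : _root_.ResolutionOfSingularities :=
  closes_descent hCP hCJS hAsc (fun d hd => nonKHToricArchLUKeyHenselDescent_iff_abel.2 (hN d hd)) h₃

/-- Root-level summary: modulo floor + CJS + Π₁ + 0642 the ROOT is EQUIVALENT to the residual
family off the four cells. [folklore] -/
theorem root_iff_abel_sigma (hCP : CossartPiltant2019LU3.{0})
    (hCJS : CossartJannsenSaito2020Embedded.{0}) (hAsc : KK05NCVAscent) (h₃ : Valuative.PatchingRel) :
    _root_.ResolutionOfSingularities ↔ ∀ d, 4 ≤ d → NonKHToricArchLUKeyHenselDescentAbel 3 3 d := by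
  rw [root_iff_descent_sigma hCP hCJS hAsc h₃]
  exact forall₂_congr fun d _ => nonKHToricArchLUKeyHenselDescent_iff_abel

end Cut

end Summit.ResolutionOfSingularities.ResolutionOfSingularities.Theorems.TameAbelianQuotientLU

end
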